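import Summits.FinalStateConjecture.FinalStateConjecture.Theorems.ExactKerrEndsTameEscapeToKerrEndsUnitCurve
import Summits.FinalStateConjecture.FinalStateConjecture.Theorems.ExactKerrEndsTameEscapeToKerrEndsMinkowskiLeaf
import HarnessLib

/-!
# Route `ExactKerrEnds`, glue item `TameEscapeGivenMassTheorems` (stmt-FinalStateConjecture-18158)
# from the stubs of crux `TameEscapeToKerrEnds` and the two promoted positive-mass items

The glue item of the route (rev 5) is
`TameEscapeGivenMassTheorems := AdmissibleMassNonneg → ZeroMassAdmissibleMinkowskian → TameEscapeToKerrEnds`: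
the crux E = `TameEscapeToKerrEnds` (stmt-FinalStateConjecture-18522) GIVEN the positive mass theorem on
the admissible class (#6 `AdmissibleMassNonneg`, stmt-18051) and its rigidity case (#7
`ZeroMassAdmissibleMinkowskian`, stmt-18053). This file records, sorry-free, what the item reduces to:

* `nonposMassKerrEnded_of_massNonneg_of_zeroMassMinkowskian` — stub S2 `NonposMassKerrEnded` of the
  registered line `matched-kerr-solution-map` from the two ITEMS (no Literature positive-mass fact): an
  admissible datum with DR mass parameter `M ≤ 0` on a sole end has `M = 0` (#6), hence a Cauchy
  development which is Minkowski space (#7), hence an exact Kerr end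
  (`hasExactKerrEnd_of_cauchyDevelopment_eq_minkowski`, landed);
* `tameEscapeGivenMassTheorems_of_matchedKerrGluing` / `…_of_matchedKerrGluingCurve` /
  `…_of_unitKerrGluingCurve` — the item from the analytic stub of the line in each of its three landed
  shapes: the registered radius-indexed S1 `MatchedKerrGluingFamily`, the curve-indexed S1♭, and the
  UNIT-SCALE form S1♭♭ (first hypothesis of the landed
  `tameEscapeToKerrEnds_of_unitKerrGluingCurve_of_pmt_of_rigidity`), composed with the landed glue
  `tameEscapeToKerrEnds_of_matchedKerrGluing(Curve)_of_nonposMassKerrEnded` and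
  `matchedKerrGluingCurve_of_unitCurve`;
* conversely the item is trivially implied by the crux itself (discard the two hypotheses), so modulo
  the tree it is EQUIVALENT to the crux given #6/#7: its only open content is S1♭♭ (Corvino–Schoen 2006
  Thm 4 / Chruściel–Delay 2003 Thm 8.1 / Mao–Oh–Tao 2023 Thm 1.3 at every radius, with smooth dependence
  along a curve of radii and `o(1/R)` weighted `C² × C¹` control — not in print, not in tree).

References: Corvino–Schoen, J. Differential Geom. 73 (2006), Thms 1, 4, 5; Beig–Chruściel, J. Math.
Phys. 37 (1996), Thm 4.1; Eichmair–Huang–Lee–Schoen, JEMS 18 (2016), Thm 1; Christodoulou, CQG 16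
(1999) A23, p. A24.
-/

set_option linter.dupNamespace false

noncomputable section

namespace Summit.FinalStateConjecture.FinalStateConjecture.Theorems.ExactKerrEnds

open scoped Manifold ContDiff Topology
open Set Filter Function Metric Bornology Asymptotics TopologicalSpace Literature.Geometry.Lorentzian
open Summit.FinalStateConjecture.FinalStateConjecture.Theorems.SwallowTheDatum.ParametricKerrBurial
  (SmoothSectionsOn AgreeAt VacuumOn)
open Summit.FinalStateConjecture.FinalStateConjecture.Theses.ExactKerrEnds
  (AdmissibleMassNonneg ZeroMassAdmissibleMinkowskian TameEscapeToKerrEnds TameEscapeGivenMassTheorems)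

/-! ### Stub S2 from the two promoted positive-mass items -/

/-- **Stub S2 `NonposMassKerrEnded` of crux `TameEscapeToKerrEnds`, line `matched-kerr-solution-map`,
from the route items `AdmissibleMassNonneg` (#6, positive mass theorem on the admissible vacuum class)
and `ZeroMassAdmissibleMinkowskian` (#7, its rigidity case).** For an admissible vacuum datum `d` with a
sole Dafermos–Rodnianski end `e` of mass parameter `M ≤ 0`: #6 gives `0 ≤ M`, so `M = 0`; #7 then gives
a Cauchy development of `d` WHICH IS Minkowski space, and a datum with such a development is Kerr-ended
with `M = a = 0` (`hasExactKerrEnd_of_cauchyDevelopment_eq_minkowski`). The statement is the registered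
stub S2 verbatim; no Literature positive-mass fact is used. [cite: BeigChrusciel1996, Thm. 4.1] -/
theorem nonposMassKerrEnded_of_massNonneg_of_zeroMassMinkowskian
    (hP : AdmissibleMassNonneg) (hZ : ZeroMassAdmissibleMinkowskian) :
    ∀ (X : Type) [TopologicalSpace X] [ChartedSpace E3 X] [IsManifold (𝓡 3) ∞ X] [T2Space X]
      [SecondCountableTopology X] [ConnectedSpace X],
      ∀ d ∈ admissibleVacuumData X, ∀ (e : AFEnd X) (M : ℝ), e.IsSoleEnd → M ≤ 0 →
        e.IsStronglyAsymptoticallyFlatDR d M → d.HasExactKerrEnd := by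
  intro X _ _ _ _ _ _ d hd e M hsole hM hDR
  have hM0 : M = 0 := le_antisymm hM (hP X d hd e M hsole hDR)
  subst hM0
  obtain ⟨𝒟, h𝒟⟩ := hZ X d hd e hsole hDR
  intro _
  exact hasExactKerrEnd_of_cauchyDevelopment_eq_minkowski X d e hsole 𝒟 h𝒟

/-! ### The glue item from the analytic stub of the line, in its three landed shapes -/

/-- **The glue item `TameEscapeGivenMassTheorems` from the registered radius-indexed stub S1
`MatchedKerrGluingFamily`** (charge-matched exterior Kerr gluing along the gluing radius with a smooth
solution map: Corvino–Schoen 2006 Thm 4 / Chruściel–Delay 2003 Thm 8.1 / Mao–Oh–Tao 2023 Thm 1.3, run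
for every radius; stated verbatim as the hypothesis, with the skeleton's `IsChartExactKerrBeyond`
unfolded): given #6 and #7, S2 holds (`nonposMassKerrEnded_of_massNonneg_of_zeroMassMinkowskian`) and
the landed glue `tameEscapeToKerrEnds_of_matchedKerrGluing_of_nonposMassKerrEnded` (S3a/S3b discharged)
yields the crux. [cite: CorvinoSchoen2006, Thm 4] -/
theorem tameEscapeGivenMassTheorems_of_matchedKerrGluing
    (h1 : ∀ (X : Type) [TopologicalSpace X] [ChartedSpace E3 X] [IsManifold (𝓡 3) ∞ X] [T2Space X]
      [SecondCountableTopology X] [ConnectedSpace X], ∀ [Kerr.Facts],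
      ∀ d ∈ admissibleVacuumData X, ∀ (e : AFEnd X) (M : ℝ), e.IsSoleEnd → 0 < M →
        e.IsStronglyAsymptoticallyFlatDR d M →
        ∃ (Rstar : ℝ) (m : ℝ → ℝ) (G : ℝ → InitialDataSet (𝓡 3) X),
          e.R < Rstar ∧ ContinuousOn m (Ioi Rstar) ∧ Tendsto m atTop (𝓝 M) ∧
          SmoothSectionsOn 𝓘(ℝ, ℝ) G {p : ℝ × X | Rstar < p.1} ∧
          (∀ R : ℝ, Rstar < R →
            G R ∈ admissibleVacuumData X ∧ (∀ x ∉ e.far R, AgreeAt (G R) d x) ∧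
              e.IsStronglyAsymptoticallyFlatDR (G R) (m R) ∧
              ∃ (M' a r₀ : ℝ) (hM' : 0 ≤ M') (ψ : exteriorRegion (4 * R) → Kerr.region a r₀)
                (ν : NormalField 𝓘(ℝ, E4) ψ),
                Injective ψ ∧
                (Kerr.smoothMetric M' a r₀).IsSpacelikeImmersion 𝓘(ℝ, E3) ψ ∧
                (Kerr.smoothMetric M' a r₀).IsFutureUnitNormal 𝓘(ℝ, E3)
                  ((Kerr.timeOrientation M' a r₀ hM').ofLE le_top) ψ ν ∧
                (∀ (y : exteriorRegion (4 * R)) (v w : E3),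
                  AFEnd.hCoeff e (G R) (y : E3) v w =
                    Kerr.bilin M' a (ψ y : E4) (mfderiv 𝓘(ℝ, E3) 𝓘(ℝ, E4) ψ y v)
                      (mfderiv 𝓘(ℝ, E3) 𝓘(ℝ, E4) ψ y w)) ∧
                (∀ [(Kerr.smoothMetric M' a r₀).HasLeviCivita] (y : exteriorRegion (4 * R))
                  (v w : E3),
                  AFEnd.kCoeff e (G R) (y : E3) v w =
                    (Kerr.smoothMetric M' a r₀).secondFundamentalForm 𝓘(ℝ, E3) ψ ν y v w)) ∧
          Tendsto (fun R ↦ e.wDist (G R) d) atTop (𝓝 0)) :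
    TameEscapeGivenMassTheorems := by
  intro hP hZ
  exact tameEscapeToKerrEnds_of_matchedKerrGluing_of_nonposMassKerrEnded h1
    (nonposMassKerrEnded_of_massNonneg_of_zeroMassMinkowskian hP hZ)

/-- **The glue item `TameEscapeGivenMassTheorems` from the curve-indexed analytic stub S1♭**: along a
curve `s ↦ G s` of admissible Kerr-ended data, jointly smooth in `(s, x)`, equal to `d` off
`e.far (ρ s)` with `ρ s → ∞`, DR on `e` with continuous masses `m s → M` and `e.wDist (G s) d → 0`
(for every admissible `d` with sole DR end of mass `M > 0`); given #6 and #7, S2 holds and the landed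
curve-indexed glue `tameEscapeToKerrEnds_of_matchedKerrGluingCurve_of_nonposMassKerrEnded` yields the
crux. [cite: CorvinoSchoen2006, Thm 4] -/
theorem tameEscapeGivenMassTheorems_of_matchedKerrGluingCurve
    (h1 : ∀ (X : Type) [TopologicalSpace X] [ChartedSpace E3 X] [IsManifold (𝓡 3) ∞ X] [T2Space X]
      [SecondCountableTopology X] [ConnectedSpace X], ∀ [Kerr.Facts],
      ∀ d ∈ admissibleVacuumData X, ∀ (e : AFEnd X) (M : ℝ), e.IsSoleEnd → 0 < M →
        e.IsStronglyAsymptoticallyFlatDR d M →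
        ∃ (sstar : ℝ) (ρ m : ℝ → ℝ) (G : ℝ → InitialDataSet (𝓡 3) X),
          Tendsto ρ atTop atTop ∧ ContinuousOn m (Ioi sstar) ∧ Tendsto m atTop (𝓝 M) ∧
          SmoothSectionsOn 𝓘(ℝ, ℝ) G {p : ℝ × X | sstar < p.1} ∧
          (∀ s : ℝ, sstar < s →
            G s ∈ admissibleVacuumData X ∧ (∀ x ∉ e.far (ρ s), AgreeAt (G s) d x) ∧
              e.IsStronglyAsymptoticallyFlatDR (G s) (m s) ∧ (G s).HasExactKerrEnd) ∧
          Tendsto (fun s ↦ e.wDist (G s) d) atTop (𝓝 0)) :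
    TameEscapeGivenMassTheorems := by
  intro hP hZ
  exact tameEscapeToKerrEnds_of_matchedKerrGluingCurve_of_nonposMassKerrEnded h1
    (nonposMassKerrEnded_of_massNonneg_of_zeroMassMinkowskian hP hZ)

/-- **The glue item `TameEscapeGivenMassTheorems` from the UNIT-SCALE analytic stub S1♭♭** (the line's
one remaining open stub, first hypothesis of the landed
`tameEscapeToKerrEnds_of_unitKerrGluingCurve_of_pmt_of_rigidity`, stated verbatim): along a smooth
curve of gluing radii `R s → ∞`, data `O s` on `ℝ³` at unit scale — vacuum on `{1 < ‖y‖}`, equal to the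
rescaled chart data of `d` on `{1 < ‖y‖ < 2}`, DR-flat at unit scale with mass `μ s` (`R s μ s → M`),
within `ε s` of the rescaled chart data of `d` in weighted `C² × C¹` (`R s ε s → 0`), jointly smooth,
and an exact spacelike Kerr leaf beyond `32 R s` after dilation by `R s`. The unit-scale bookkeeping
`matchedKerrGluingCurve_of_unitCurve` (landed) turns it into S1♭, whence the item
(`tameEscapeGivenMassTheorems_of_matchedKerrGluingCurve`). Once S1♭♭ lands, the item closes by this
theorem (restated Theses-free for the gate). [cite: CorvinoSchoen2006, Thm 4] -/
theorem tameEscapeGivenMassTheorems_of_unitKerrGluingCurve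
    (h : ∀ (X : Type) [TopologicalSpace X] [ChartedSpace E3 X] [IsManifold (𝓡 3) ∞ X] [T2Space X]
      [SecondCountableTopology X] [ConnectedSpace X], ∀ [Kerr.Facts],
      ∀ d ∈ admissibleVacuumData X, ∀ (e : AFEnd X) (M : ℝ), e.IsSoleEnd → 0 < M →
        e.IsStronglyAsymptoticallyFlatDR d M →
        ∃ (sstar : ℝ) (R μ ε : ℝ → ℝ) (O : ℝ → InitialDataSet (𝓡 3) E3),
          ContDiff ℝ ∞ R ∧ (∀ s, sstar < s → max e.R 1 < R s) ∧ Tendsto R atTop atTop ∧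
          ContinuousOn μ (Ioi sstar) ∧ Tendsto (fun s ↦ R s * μ s) atTop (𝓝 M) ∧
          Tendsto (fun s ↦ R s * ε s) atTop (𝓝 0) ∧
          SmoothSectionsOn 𝓘(ℝ, ℝ) O {p : ℝ × E3 | sstar < p.1 ∧ 1 < ‖p.2‖} ∧
          ∀ s, sstar < s →
            VacuumOn {y | 1 < ‖y‖} (O s) ∧
            (∀ y : E3, 1 < ‖y‖ → ‖y‖ < 2 →
              (O s).coordH y = AFEnd.hCoeff e d (R s • y) ∧
                (O s).coordK y = R s • AFEnd.kCoeff e d (R s • y)) ∧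
            (∀ m : ℕ, m ≤ 2 →
              (fun y ↦ ‖iteratedFDeriv ℝ m
                  (fun y ↦ (O s).coordH y - (1 + 2 * μ s / ‖y‖) • (innerSL ℝ : E3 →L[ℝ] E3 →L[ℝ] ℝ)) y‖)
                =o[cobounded E3] fun y ↦ ‖y‖ ^ (-1 - m : ℝ)) ∧
            (∀ m : ℕ, m ≤ 1 →
              (fun y ↦ ‖iteratedFDeriv ℝ m (O s).coordK y‖) =o[cobounded E3] fun y ↦ ‖y‖ ^ (-2 - m : ℝ)) ∧
            (∀ m : ℕ, m ≤ 2 → ∀ y : E3, 1 < ‖y‖ →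
              ‖y‖ ^ (1 + m) *
                ‖iteratedFDeriv ℝ m (fun y ↦ (O s).coordH y - AFEnd.hCoeff e d (R s • y)) y‖ ≤ ε s) ∧
            (∀ m : ℕ, m ≤ 1 → ∀ y : E3, 1 < ‖y‖ →
              ‖y‖ ^ (2 + m) *
                ‖iteratedFDeriv ℝ m (fun y ↦ (O s).coordK y - R s • AFEnd.kCoeff e d (R s • y)) y‖ ≤ ε s) ∧
            ∃ (M' a r₀ : ℝ) (hM' : 0 ≤ M') (ψ : exteriorRegion (32 * R s) → Kerr.region a r₀)
              (ν : NormalField 𝓘(ℝ, E4) ψ),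
              Injective ψ ∧
              (Kerr.smoothMetric M' a r₀).IsSpacelikeImmersion 𝓘(ℝ, E3) ψ ∧
              (Kerr.smoothMetric M' a r₀).IsFutureUnitNormal 𝓘(ℝ, E3)
                ((Kerr.timeOrientation M' a r₀ hM').ofLE le_top) ψ ν ∧
              (∀ (y : exteriorRegion (32 * R s)) (v w : E3),
                ((O s).dilateFamily (R s)).coordH (y : E3) v w =
                  Kerr.bilin M' a (ψ y : E4) (mfderiv 𝓘(ℝ, E3) 𝓘(ℝ, E4) ψ y v)
                    (mfderiv 𝓘(ℝ, E3) 𝓘(ℝ, E4) ψ y w)) ∧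
              (∀ [(Kerr.smoothMetric M' a r₀).HasLeviCivita] (y : exteriorRegion (32 * R s)) (v w : E3),
                ((O s).dilateFamily (R s)).coordK (y : E3) v w =
                  (Kerr.smoothMetric M' a r₀).secondFundamentalForm 𝓘(ℝ, E3) ψ ν y v w)) :
    TameEscapeGivenMassTheorems :=
  tameEscapeGivenMassTheorems_of_matchedKerrGluingCurve
    (fun X _ _ _ _ _ _ _ d hd e M hsole hM hDR ↦ matchedKerrGluingCurve_of_unitCurve hd hsole
      (h X d hd e M hsole hM hDR))

end Summit.FinalStateConjecture.FinalStateConjecture.Theorems.ExactKerrEnds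

end
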